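import Literature.NumberTheory.LFunctions.ZetaDerivativeZerosSmallGapsRadziwill
import Literature.NumberTheory.LFunctions.SubnormalZetaGapsLOneLowerBound
import HarnessLib

/-!
# Route `PrimeLevelFamEdge` — TYPED IDEA DELTAS, deck 23: `barrier` lens × CI-GAPS — K-L21-4 «THE ζ′-DOOR AT ONE SCALE»
# (cell ls-idea, seat ls-idea-lens-21 gen 3, card K-L21-4; the seat's `Sketch_L21_ZetaPrimeWindow.lean` sha16 7a15b6a026a0af8d,
# critic F b27 PASS (class VARIANT + NEW-COMBINATION rider E1; lever LOW; door-X value NIL; F's own kernel re-run + junk tests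
# J1–J4); LANDING NOTE typer ls-idea-typ-1 gen 3: VERBATIM (already in the deck namespace) up to this header and F's
# attribution fix F-F27-1 in the docstring of `FixedScaleConsumer`.)

Statement shapes only; nothing here is a theorem about `ζ`.  Units are Radziwiłł's / Farmer–Ki's: abscissa
`ν = (β′ − ½) log T`, consecutive gaps `(γ_{n+1} − γ_n) log T`, mean spacing `2π`, HALF the mean spacing `= π`
(`Radziwill2014.derivRatio`, `Radziwill2014.gapRatio` are the tree's normalised counts on `[T, 2T]`).
* `FixedScaleDerivSupply ν₀ η₀` — the PRODUCER target at one scale: eventually in `T`,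
  `(2π/(T log T)) · #{T ≤ γ′ ≤ 2T : (β′ − ½) log T ≤ ν₀} ≥ η₀` (`m′(ν₀) ≥ η₀` with the `liminf` unfolded). For
  `ν₀ ≥ 0.76` this is CONSISTENT with an AH ∧ RH(ζ) world (card K-L21-4 table E1, F-corrected E1″); for `ν₀ ≲ 0.47` and
  `η₀` above the Tsang price of one-sided clusters it is AH-false (door-capable).
* `FixedScaleGapSupply ε c` — eventually `(2π/(T log T)) · #{T ≤ γ_n ≤ 2T : gap·log T ≤ ε} ≥ c`.
* `FixedScaleConsumer ν₀ η₀ ε` — the CONSUMER shape at one scale (pencil: Farmer–Ki §2.1–2.2 + lens-23's forcing lemma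
  N7a + Tsang's local-count tail, read at a single `ν₀`).  IN PRINT only below Radziwiłł's threshold `C(δ,A)` (Theorem 1,
  arXiv:1301.3232 p. 3 L28–31) and in the `∀ ν → 0` / power-rate forms (`farmerKi`, `radziwill2014_mainTheorem_i`); NOT in
  print at the working point `ν₀ ∈ [0.1, 0.25]` (F-F27-1).
* `GapSupplyFeedsCI ε` — glue target: for `ε < π` a positive log-proportion of `ε`-small consecutive gaps on every dyadic
  `[T, 2T]` gives Conrey–Iwaniec's (1.22) count `≫ T (log T)^{4/5}` (`SubnormalGapsHypothesis`; needs RH and `ε < π`).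
* `lOne_of_fixedScaleDoor` — PROVED composition: consumer + glue + RH + supply + CI Theorem 1.2 (named fact
  `conreyIwaniec2002_theorem12`) ⇒ `‖L(1,χ)‖ ≥ c′ (log q)^{−90}` for odd real primitive χ.
HONESTY: no exceptional-zero theorem (no Landau–Siegel / Siegel-zero exclusion, no Theorem 1–2 of arXiv:2211.02515, no repaired
Margin232) is proved; the composition is logic over HYPOTHESES (consumer, glue, RH, supply, CI Thm 1.2); typed ≠ proved.
-/

noncomputable section

namespace Summit.Parity.GeneralizedHardyLittlewood.Theorems.PrimeLevelFamEdgeIdeaDeltas.ZetaPrimeWindow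

open Literature.NumberTheory.LFunctions

/-- PRODUCER target at one scale `ν₀` with proportion `η₀` (Radziwiłł's `m′(ν₀) ≥ η₀`, liminf unfolded).
[cite: Radziwill2014ZetaPrimeGaps, §1 p. 2 (definition of m′(ε))] -/
def FixedScaleDerivSupply (ν₀ η₀ : ℝ) : Prop :=
  ∃ T₀ : ℝ, ∀ T : ℝ, T₀ ≤ T → η₀ ≤ Radziwill2014.derivRatio ν₀ T

/-- Gap supply at one threshold `ε` with proportion `c` (Radziwiłł's `m(ε) ≥ c`, liminf unfolded).
[cite: Radziwill2014ZetaPrimeGaps, §1 p. 2 (definition of m(ε))] -/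
def FixedScaleGapSupply (ε c : ℝ) : Prop :=
  ∃ T₀ : ℝ, ∀ T : ℝ, T₀ ≤ T → c ≤ Radziwill2014.gapRatio ε T

/-- CONSUMER shape at one scale: RH ∧ `m′(ν₀) ≥ η₀` ⇒ `m(ε) ≥ c > 0`. A target, never asserted;
meaningful for `ν₀` below the clock abscissa floor and `η₀` above the cluster price (card K-L21-4).  In print only in
the `∀ν` form (Farmer–Ki Thm 1.3), the power-rate form (Radziwiłł, Main Theorem) and at one scale BELOW Radziwiłł's
threshold `C(δ,A)` (Radziwiłł, Theorem 1) — not at the card's working point (critic F, F-F27-1).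
[cite: FarmerKi2012, Theorem 1.3 (the ∀ν form); Radziwill2014ZetaPrimeGaps, Main Theorem (power-rate form) and Theorem 1 (one scale below C(δ,A))] -/
def FixedScaleConsumer (ν₀ η₀ ε : ℝ) : Prop :=
  RiemannHypothesis → FixedScaleDerivSupply ν₀ η₀ → ∃ c : ℝ, 0 < c ∧ FixedScaleGapSupply ε c

/-- GLUE target: sub-`π` consecutive gaps at positive log-proportion feed Conrey–Iwaniec (1.22).
[cite: ConreyIwaniec2002, Theorem 1.2 (1.22); FarmerKi2012, §1 (remark before Theorem 1.3: gaps `ν < π` suffice)] -/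
def GapSupplyFeedsCI (ε : ℝ) : Prop :=
  RiemannHypothesis → ∀ c : ℝ, 0 < c → FixedScaleGapSupply ε c →
    ∃ c' : ℝ, 0 < c' ∧ SubnormalGapsHypothesis c'

/-- Monotonicity in the proportion (sanity: the supply predicate is not vacuous in `η₀`). -/
theorem FixedScaleDerivSupply.mono {ν₀ η₀ η₁ : ℝ} (h : η₁ ≤ η₀)
    (hs : FixedScaleDerivSupply ν₀ η₀) : FixedScaleDerivSupply ν₀ η₁ := by
  obtain ⟨T₀, hT⟩ := hs
  exact ⟨T₀, fun T hT' => h.trans (hT T hT')⟩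

/-- The trivial instance: proportion `η₀ ≤ 0` is always supplied (counts are nonnegative) — so the
door's content is entirely in `η₀ > 0` exceeding the cluster price. -/
theorem fixedScaleDerivSupply_of_nonpos {ν₀ η₀ : ℝ} (h : η₀ ≤ 0) :
    FixedScaleDerivSupply ν₀ η₀ := by
  refine ⟨1, fun T hT => h.trans ?_⟩
  unfold Radziwill2014.derivRatio
  have hT0 : 0 < T := by linarith
  have hlog : 0 ≤ Real.log T := Real.log_nonneg hT
  positivity

/-- PROVED composition (logic only): a fixed-scale consumer, the CI glue, RH and a fixed-scale
`ζ′`-supply give Conrey–Iwaniec's hypothesis (1.22), hence — with CI Theorem 1.2 as a named fact —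
`‖L(1,χ)‖ ≥ c′ (log q)^{−90}` for every odd real primitive `χ` mod `q > 4`.
[cite: ConreyIwaniec2002, Theorem 1.2] -/
theorem lOne_of_fixedScaleDoor {ν₀ η₀ ε : ℝ} (hC : FixedScaleConsumer ν₀ η₀ ε)
    (hG : GapSupplyFeedsCI ε) (hCI : conreyIwaniec2002_theorem12)
    (hRH : RiemannHypothesis) (hX : FixedScaleDerivSupply ν₀ η₀) :
    ∃ c' : ℝ, 0 < c' ∧
      ∀ (q : ℕ) [NeZero q], 4 < q → ∀ χ : DirichletCharacter ℂ q,
        χ.IsPrimitive → χ.IsQuadratic → χ.Odd →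
          c' * Real.log q ^ (-(90 : ℝ)) ≤ ‖χ.LFunction 1‖ := by
  obtain ⟨c, hc, hgap⟩ := hC hRH hX
  obtain ⟨c₁, hc₁, hsub⟩ := hG hRH c hc hgap
  obtain ⟨c', hc', himp⟩ := hCI c₁ hc₁
  exact ⟨c', hc', himp hsub⟩

end Summit.Parity.GeneralizedHardyLittlewood.Theorems.PrimeLevelFamEdgeIdeaDeltas.ZetaPrimeWindow
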